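import Mathlib.Analysis.SpecialFunctions.Pow.Real
import Mathlib.Algebra.Order.Floor.Semiring
import Mathlib.Tactic
import HarnessLib

/-!
# Kozma–Nachmias 2011, Lemma 2.3: the bookkeeping of the parameters

Barrier catalogue `Literature/Barriers/CriticalPhenomena/` (D-0021), companion of
`KozmaNachmiasOneArm.lean`. Pure real arithmetic, PROVED: the choice of the parameters in the proof of
Kozma–Nachmias 2011, Lemma 2.3 (pp. 382–384) — "define `L = ε^{3/10} r` … for every integer
`1 ≤ i ≤ λε^{-3/10}/4` let `j_i = r + λr/4 + iL ∈ [r(1+λ/4), r(1+λ/2)]` … if `|C(0)| < εr⁴`, then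
`|{i : A_{j_i} ≥ c₂L⁴}| < εr⁴/(c₂L⁴) = c₂⁻¹ε^{-1/5}` … `L > (8r)^{1/10} > j^{1/10}` … with `ε`
sufficiently small, depending on `λ`" — with `ε = η^{10}` and all roundings made explicit
(`lemma23_parameters`). Here `L = ⌊η³r/(2d)⌋` (the `2d` absorbs the number of edges leaving a site,
see `KozmaNachmiasRegeneration.lean`), the range of `j` is `[⌈r(1+λ/4)⌉, ⌊r(1+λ/2)⌋ - 1]`, the
number of radii is `N = ⌊(j₂-j₁)/L⌋ + 1 ≥ dλ/(4η³)`, the volume cut-off is `V = ⌈η^{10}r⁴⌉`, and the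
smallness condition on `η` is `η ≤ c²λ/(4096 d³)`; the main range is `η^{10} r³ > (4d)^{10}`
(the source's `ε > 2r^{-3}`).

## References

* G. Kozma, A. Nachmias, J. Amer. Math. Soc. 24 (2011) 375–409: proof of Lemma 2.3, pp. 382–384.
-/

noncomputable section

namespace Literature.Barriers.CriticalPhenomena

/-! ### Elementary helpers -/

section Helpers

/-- `⌊a⌋ + ⌊b⌋ ≤ ⌊a + b⌋` for `a, b ≥ 0`. [folklore] -/
theorem natFloor_add_natFloor_le {a b : ℝ} (ha : 0 ≤ a) (hb : 0 ≤ b) : ⌊a⌋₊ + ⌊b⌋₊ ≤ ⌊a + b⌋₊ := by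
  refine Nat.le_floor ?_
  push_cast
  exact add_le_add (Nat.floor_le ha) (Nat.floor_le hb)

/-- `x ≤ y^m` implies `x^{1/m} ≤ y` (`x, y ≥ 0`, `m ≠ 0`). [folklore] -/
theorem rpow_one_div_le_of_le_pow {x y : ℝ} (hx : 0 ≤ x) (hy : 0 ≤ y) {m : ℕ} (hm : m ≠ 0)
    (h : x ≤ y ^ m) : x ^ ((1 : ℝ) / m) ≤ y := by
  calc x ^ ((1 : ℝ) / m) ≤ (y ^ m) ^ ((1 : ℝ) / m) := Real.rpow_le_rpow hx h (by positivity)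
    _ = y := by rw [one_div]; exact Real.pow_rpow_inv_natCast hy hm

/-- Integer division: `(a / b : ℕ) + 1 > a / b` as reals (`b > 0`). [folklore] -/
theorem div_lt_natDiv_add_one {a b : ℕ} (hb : 0 < b) : (a : ℝ) / b < (a / b : ℕ) + 1 := by
  have h := Nat.lt_div_mul_add hb (a := a)
  have hb' : (0 : ℝ) < b := by exact_mod_cast hb
  rw [div_lt_iff₀ hb']
  have : (a : ℝ) < (a / b : ℕ) * b + b := by exact_mod_cast h
  linarith

/-- From `a^n < b^n` (`b ≥ 0`) to `a < b`; `n`-th root of the main-range condition: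
`(4d)^{10} < η^{10} r³` and `r ≥ 1` give `64 d³ < η³ r` and `2r ≤ (η³r/(4d))^{10}`. [folklore] -/
theorem range_consequences {d : ℕ} (hd : 7 ≤ d) {η r : ℝ} (hη0 : 0 < η) (hr : 1 ≤ r)
    (hrange : (4 * d : ℝ) ^ 10 < η ^ 10 * r ^ 3) :
    64 * (d : ℝ) ^ 3 < η ^ 3 * r ∧ 2 * r ≤ (η ^ 3 * r / (4 * d)) ^ 10 := by
  have hd0 : (0 : ℝ) < d := by exact_mod_cast (show 0 < d by omega)
  have hd1 : (1 : ℝ) ≤ d := by exact_mod_cast (show 1 ≤ d by omega)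
  have hr0 : 0 < r := by linarith
  have hbase : 0 ≤ η ^ 10 * r ^ 3 := by positivity
  -- `(η¹⁰ r³)³ > (4d)³⁰`
  have hcube : ((4 * d : ℝ) ^ 10) ^ 3 < (η ^ 10 * r ^ 3) ^ 3 :=
    pow_lt_pow_left₀ hrange (by positivity) three_ne_zero
  constructor
  · -- `(η³ r)^{10} = (η^{10} r³)³ r ≥ (η^{10} r³)^3 > ((4d)^3)^{10}`
    have h1 : ((4 * d : ℝ) ^ 3) ^ 10 < (η ^ 3 * r) ^ 10 := by
      calc ((4 * d : ℝ) ^ 3) ^ 10 = ((4 * d : ℝ) ^ 10) ^ 3 := by ring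
        _ < (η ^ 10 * r ^ 3) ^ 3 := hcube
        _ ≤ (η ^ 10 * r ^ 3) ^ 3 * r := le_mul_of_one_le_right (by positivity) hr
        _ = (η ^ 3 * r) ^ 10 := by ring
    have h2 : (4 * d : ℝ) ^ 3 < η ^ 3 * r := lt_of_pow_lt_pow_left₀ 10 (by positivity) h1
    calc 64 * (d : ℝ) ^ 3 = (4 * d : ℝ) ^ 3 := by ring
      _ < η ^ 3 * r := h2
  · calc 2 * r ≤ (4 * d : ℝ) ^ 20 * r := by
          refine mul_le_mul_of_nonneg_right ?_ hr0.le
          calc (2 : ℝ) ≤ 4 ^ 20 := by norm_num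
            _ ≤ (4 * d : ℝ) ^ 20 := pow_le_pow_left₀ (by norm_num) (by linarith) 20
      _ = ((4 * d : ℝ) ^ 10) ^ 3 * r / (4 * d : ℝ) ^ 10 := by field_simp
      _ ≤ (η ^ 10 * r ^ 3) ^ 3 * r / (4 * d : ℝ) ^ 10 := by gcongr
      _ = (η ^ 3 * r / (4 * d)) ^ 10 := by field_simp

end Helpers

/-! ### The parameters of the main range -/

section Parameters

variable {d : ℕ} {c lam η r : ℝ}

/-- Smallness of `η`: from `η ≤ c²λ/(4096 d³)` (`c ≤ 1/2`, `λ ≤ 1`, `d ≥ 7`): `η ≤ λ`, `η ≤ 1`,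
`η³ ≤ η`; and in the main range (`64 d³ < η³ r`) the length of the range of radii is large,
`λ r ≥ 24`. [cite: KozmaNachmias2011, proof of Lemma 2.3 (p. 384, "with ε sufficiently small, depending on λ")] -/
theorem lemma23_smallness (hd : 7 ≤ d) (hc0 : 0 < c) (hc2 : c ≤ 1 / 2) (hlam0 : 0 < lam)
    (hlam1 : lam ≤ 1) (hη0 : 0 < η) (hη : η ≤ c ^ 2 * lam / (4096 * d ^ 3)) (hr : 1 ≤ r)
    (h64 : 64 * (d : ℝ) ^ 3 < η ^ 3 * r) :
    η ≤ lam ∧ η ≤ 1 ∧ η ^ 3 ≤ η ∧ 24 ≤ lam * r := by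
  have hd1 : (1 : ℝ) ≤ d := by exact_mod_cast (show 1 ≤ d by omega)
  have hr0 : 0 < r := by linarith
  have hd3 : (1 : ℝ) ≤ d ^ 3 := one_le_pow₀ hd1
  have hηlam : η ≤ lam := by
    refine hη.trans ?_
    rw [div_le_iff₀ (by positivity)]
    have h1 : c ^ 2 ≤ 1 := by nlinarith
    nlinarith
  have hη1 : η ≤ 1 := hηlam.trans hlam1
  have hη3 : η ^ 3 ≤ η := by
    calc η ^ 3 ≤ η ^ 1 := pow_le_pow_of_le_one hη0.le hη1 (by norm_num)
      _ = η := pow_one η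
  refine ⟨hηlam, hη1, hη3, ?_⟩
  have hηr : 64 * (d : ℝ) ^ 3 < η * r := h64.trans_le (mul_le_mul_of_nonneg_right hη3 hr0.le)
  have h1 : η * r ≤ lam * r / (4096 * d ^ 3) := by
    calc η * r ≤ c ^ 2 * lam / (4096 * d ^ 3) * r := mul_le_mul_of_nonneg_right hη hr0.le
      _ ≤ 1 * lam / (4096 * d ^ 3) * r := by gcongr; nlinarith
      _ = lam * r / (4096 * d ^ 3) := by ring
  have h2 : 64 * (d : ℝ) ^ 3 < lam * r / (4096 * d ^ 3) := hηr.trans_le h1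
  rw [lt_div_iff₀ (by positivity)] at h2
  nlinarith

/-- The radii `j₁ = ⌈r(1+λ/4)⌉`, `j₂ = ⌊r(1+λ/2)⌋ - 1` (Kozma–Nachmias 2011, p. 383:
`j ∈ [r(1+λ/4), r(1+λ/2)]`): for `r ≥ 1`, `0 < λ`, `λr ≥ 24`:
`j₂ + 1 + ⌊λr/2⌋ ≤ ⌊r(1+λ)⌋`, `r(1+λ/4) ≤ j₁`, `j₂ ≤ r(1+λ/2)`, `λr/8 ≤ j₂ - j₁`, `j₁ ≤ j₂`,
`⌊r⌋ ≤ j₁`, `1 ≤ ⌊r⌋`. [cite: KozmaNachmias2011, proof of Lemma 2.3 (p. 383, the range of j)] -/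
theorem lemma23_radii (hlam0 : 0 < lam) (hr : 1 ≤ r) (hlamr : 24 ≤ lam * r) :
    (⌊r * (1 + lam / 2)⌋₊ - 1) + 1 + ⌊lam * r / 2⌋₊ ≤ ⌊r * (1 + lam)⌋₊ ∧
      r * (1 + lam / 4) ≤ (⌈r * (1 + lam / 4)⌉₊ : ℝ) ∧
      ((⌊r * (1 + lam / 2)⌋₊ - 1 : ℕ) : ℝ) ≤ r * (1 + lam / 2) ∧
      lam * r / 8 ≤ (((⌊r * (1 + lam / 2)⌋₊ - 1) - ⌈r * (1 + lam / 4)⌉₊ : ℕ) : ℝ) ∧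
      ⌈r * (1 + lam / 4)⌉₊ ≤ ⌊r * (1 + lam / 2)⌋₊ - 1 ∧
      ⌊r⌋₊ ≤ ⌈r * (1 + lam / 4)⌉₊ ∧ 1 ≤ ⌊r⌋₊ := by
  have hr0 : 0 < r := by linarith
  set j₁ : ℕ := ⌈r * (1 + lam / 4)⌉₊ with hj₁
  set f : ℕ := ⌊r * (1 + lam / 2)⌋₊ with hf
  have hfl1 : 1 ≤ ⌊r⌋₊ := Nat.le_floor (by simpa using hr)
  have hfl2 : ⌊r⌋₊ ≤ f := Nat.floor_le_floor (le_mul_of_one_le_right hr0.le (by linarith))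
  have hf1 : 1 ≤ f := hfl1.trans hfl2
  have hj₂1 : f - 1 + 1 = f := Nat.sub_add_cancel hf1
  have hP1 : f - 1 + 1 + ⌊lam * r / 2⌋₊ ≤ ⌊r * (1 + lam)⌋₊ := by
    rw [hj₂1]
    have := natFloor_add_natFloor_le (a := r * (1 + lam / 2)) (b := lam * r / 2) (by positivity)
      (by positivity)
    rwa [show r * (1 + lam / 2) + lam * r / 2 = r * (1 + lam) by ring] at this
  have hj₁lt : (j₁ : ℝ) < r * (1 + lam / 4) + 1 := Nat.ceil_lt_add_one (by positivity)
  have hj₁ge : r * (1 + lam / 4) ≤ j₁ := Nat.le_ceil _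
  have hcast : (((f - 1 : ℕ)) : ℝ) = (f : ℝ) - 1 := by
    rw [Nat.cast_sub hf1, Nat.cast_one]
  have hj₂ge : r * (1 + lam / 2) - 2 ≤ ((f - 1 : ℕ) : ℝ) := by
    rw [hcast]
    have h2 : r * (1 + lam / 2) - 1 < f := Nat.sub_one_lt_floor _
    linarith
  have hj₂le : ((f - 1 : ℕ) : ℝ) ≤ r * (1 + lam / 2) := by
    rw [hcast]
    linarith [Nat.floor_le (show 0 ≤ r * (1 + lam / 2) by positivity)]
  have hdiff : lam * r / 8 ≤ (((f - 1) - j₁ : ℕ) : ℝ) := by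
    have h1 : lam * r / 8 ≤ ((f - 1 : ℕ) : ℝ) - j₁ := by linarith
    have h2 : ((f - 1 : ℕ) : ℝ) - j₁ ≤ (((f - 1) - j₁ : ℕ) : ℝ) := by
      rw [sub_le_iff_le_add]; exact_mod_cast le_tsub_add
    linarith
  have hj₁j₂ : j₁ ≤ f - 1 := by
    have : (j₁ : ℝ) < ((f - 1 : ℕ) : ℝ) := by linarith
    exact_mod_cast this.le
  have hP10 : ⌊r⌋₊ ≤ j₁ :=
    (Nat.floor_le_floor (le_mul_of_one_le_right hr0.le (by linarith))).trans (Nat.floor_le_ceil _)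
  exact ⟨hP1, hj₁ge, hj₂le, hdiff, hj₁j₂, hP10, hfl1⟩

/-- The width `L = ⌊η³r/(2d)⌋` (the source's `L = ε^{3/10} r`, p. 382) in the main range
`64 d³ < η³ r` (`η ≤ 1`, `r ≥ 1`, and `2r ≤ (η³r/(4d))^{10}`): `1 ≤ L`, `η³r/(4d) ≤ L ≤ r`,
`L² ≤ η⁶r²/(2d)`, `2r ≤ L^{10}`. [cite: KozmaNachmias2011, proof of Lemma 2.3 (p. 382, L = ε^{3/10} r)] -/
theorem lemma23_width (hd : 7 ≤ d) (hη0 : 0 < η) (hη1 : η ≤ 1) (hr : 1 ≤ r)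
    (h64 : 64 * (d : ℝ) ^ 3 < η ^ 3 * r) (hL10 : 2 * r ≤ (η ^ 3 * r / (4 * d)) ^ 10) :
    1 ≤ ⌊η ^ 3 * r / (2 * d)⌋₊ ∧ η ^ 3 * r / (4 * d) ≤ (⌊η ^ 3 * r / (2 * d)⌋₊ : ℝ) ∧
      (⌊η ^ 3 * r / (2 * d)⌋₊ : ℝ) ≤ r ∧
      ((⌊η ^ 3 * r / (2 * d)⌋₊ : ℕ) : ℝ) ^ 2 ≤ η ^ 6 * r ^ 2 / (2 * d) ∧
      2 * r ≤ ((⌊η ^ 3 * r / (2 * d)⌋₊ : ℕ) : ℝ) ^ 10 := by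
  have hd0 : (0 : ℝ) < d := by exact_mod_cast (show 0 < d by omega)
  have hd1 : (1 : ℝ) ≤ d := by exact_mod_cast (show 1 ≤ d by omega)
  have hr0 : 0 < r := by linarith
  have hdd : (d : ℝ) ≤ (d : ℝ) ^ 3 := by
    have := mul_nonneg (mul_nonneg hd0.le (sub_nonneg.2 hd1)) (show (0 : ℝ) ≤ d + 1 by positivity)
    nlinarith
  set x : ℝ := η ^ 3 * r / (2 * d) with hx
  have hx2 : 2 ≤ x := by
    rw [hx, le_div_iff₀ (by positivity)]
    linarith
  set L : ℕ := ⌊x⌋₊ with hL_def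
  have hLx : (L : ℝ) ≤ x := Nat.floor_le (by linarith)
  have hLlow : η ^ 3 * r / (4 * d) ≤ L := by
    have h1 : x - 1 < L := Nat.sub_one_lt_floor x
    have h2 : η ^ 3 * r / (4 * d) = x / 2 := by rw [hx]; field_simp; ring
    rw [h2]; linarith
  have hL1 : 1 ≤ L := Nat.le_floor (by push_cast; linarith)
  have hL0 : (0 : ℝ) < L := by exact_mod_cast hL1
  have hη3 : η ^ 3 ≤ 1 := pow_le_one₀ hη0.le hη1
  have hLr : (L : ℝ) ≤ r := by
    refine hLx.trans ?_
    rw [hx, div_le_iff₀ (by positivity)]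
    nlinarith
  have hP5 : ((L : ℝ)) ^ 2 ≤ η ^ 6 * r ^ 2 / (2 * d) := by
    have h1 : ((L : ℝ)) ^ 2 ≤ x ^ 2 := pow_le_pow_left₀ hL0.le hLx 2
    have h2 : x ^ 2 = η ^ 6 * r ^ 2 / (2 * d) * (1 / (2 * d)) := by rw [hx]; field_simp
    have h3 : 1 / (2 * (d : ℝ)) ≤ 1 := by rw [div_le_one (by positivity)]; linarith
    calc ((L : ℝ)) ^ 2 ≤ x ^ 2 := h1
      _ = η ^ 6 * r ^ 2 / (2 * d) * (1 / (2 * d)) := h2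
      _ ≤ η ^ 6 * r ^ 2 / (2 * d) * 1 := mul_le_mul_of_nonneg_left h3 (by positivity)
      _ = _ := mul_one _
  exact ⟨hL1, hLlow, hLr, hP5, hL10.trans (pow_le_pow_left₀ (by positivity) hLlow 10)⟩

/-- The number of radii `N = ⌊(j₂ - j₁)/L⌋ + 1` (the source's `¼λε^{-3/10}`, p. 383): for
`i < N`, `j₁ + iL ≤ j₂`, and `N ≥ dλ/(4η³)` when `λr/8 ≤ j₂ - j₁` and `L ≤ η³r/(2d)`.
[cite: KozmaNachmias2011, proof of Lemma 2.3 (p. 383, the indices i)] -/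
theorem lemma23_count {j₁ j₂ L : ℕ} (hL1 : 1 ≤ L) (hj : j₁ ≤ j₂) (hlam0 : 0 < lam) (hη0 : 0 < η)
    (hd0 : 0 < (d : ℝ)) (hdiff : lam * r / 8 ≤ ((j₂ - j₁ : ℕ) : ℝ))
    (hLx : (L : ℝ) ≤ η ^ 3 * r / (2 * d)) :
    1 ≤ (j₂ - j₁) / L + 1 ∧ (∀ i < (j₂ - j₁) / L + 1, j₁ + i * L ≤ j₂) ∧
      d * lam / (4 * η ^ 3) ≤ (((j₂ - j₁) / L + 1 : ℕ) : ℝ) := by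
  have hL0 : (0 : ℝ) < L := by exact_mod_cast hL1
  refine ⟨Nat.le_add_left 1 _, ?_, ?_⟩
  · intro i hi
    have hi' : i ≤ (j₂ - j₁) / L := Nat.lt_succ_iff.1 hi
    have h1 : i * L ≤ (j₂ - j₁) / L * L := Nat.mul_le_mul_right L hi'
    have h2 : (j₂ - j₁) / L * L ≤ j₂ - j₁ := Nat.div_mul_le_self _ _
    omega
  · have h1 : (((j₂ - j₁ : ℕ) : ℝ)) / L < (((j₂ - j₁) / L + 1 : ℕ) : ℝ) := by
      have := div_lt_natDiv_add_one (a := j₂ - j₁) (b := L) (by omega)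
      push_cast
      exact this
    have h2 : lam * r / 8 / L ≤ (((j₂ - j₁ : ℕ) : ℝ)) / L := div_le_div_of_nonneg_right hdiff hL0.le
    have h3 : d * lam / (4 * η ^ 3) ≤ lam * r / 8 / L := by
      rw [div_le_div_iff₀ (by positivity) hL0]
      calc d * lam * L ≤ d * lam * (η ^ 3 * r / (2 * d)) := mul_le_mul_of_nonneg_left hLx (by positivity)
        _ = lam * r / 8 * (4 * η ^ 3) := by field_simp; ring
    linarith

/-- The Markov step (p. 384, "with `ε` sufficiently small, depending on `λ`, this is at most
`(1 - c₁)γ(r)`"): if `V ≤ 2η^{10}r⁴`, `L ≥ η³r/(4d)`, `N ≥ dλ/(4η³)` and `η ≤ c²λ/(4096 d³)`, then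
`V/(cL⁴) ≤ 512 d⁴/(cη²) ≤ cN/2`. [cite: KozmaNachmias2011, proof of Lemma 2.3 (p. 384, choice of ε₀(λ))] -/
theorem lemma23_markov_step {L N : ℕ} {V : ℝ} (hc0 : 0 < c) (hlam0 : 0 < lam) (hη0 : 0 < η)
    (hr0 : 0 < r) (hd0 : 0 < (d : ℝ)) (hη : η ≤ c ^ 2 * lam / (4096 * d ^ 3))
    (hVle : V ≤ 2 * (η ^ 10 * r ^ 4)) (hLlow : η ^ 3 * r / (4 * d) ≤ (L : ℝ))
    (hNlow : d * lam / (4 * η ^ 3) ≤ (N : ℝ)) :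
    V / (c * (L : ℝ) ^ 4) ≤ c * N / 2 := by
  have h1 : V / (c * (L : ℝ) ^ 4) ≤ 2 * (η ^ 10 * r ^ 4) / (c * (η ^ 3 * r / (4 * d)) ^ 4) := by
    refine div_le_div₀ (by positivity) hVle (by positivity) ?_
    exact mul_le_mul_of_nonneg_left (pow_le_pow_left₀ (by positivity) hLlow 4) hc0.le
  have h2 : 2 * (η ^ 10 * r ^ 4) / (c * (η ^ 3 * r / (4 * d)) ^ 4) = 512 * d ^ 4 / (c * η ^ 2) := by
    field_simp
    ring
  have h4 : η * (4096 * d ^ 3) ≤ c ^ 2 * lam := by rwa [le_div_iff₀ (by positivity)] at hη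
  have h3 : 512 * (d : ℝ) ^ 4 / (c * η ^ 2) ≤ c * (d * lam / (4 * η ^ 3)) / 2 := by
    rw [div_le_iff₀ (by positivity)]
    have h5 : c * (d * lam / (4 * η ^ 3)) / 2 * (c * η ^ 2) = c ^ 2 * lam * d / (8 * η) := by
      field_simp
      ring
    rw [h5, le_div_iff₀ (by positivity)]
    nlinarith
  calc V / (c * (L : ℝ) ^ 4) ≤ 512 * d ^ 4 / (c * η ^ 2) := h1.trans_eq h2
    _ ≤ c * (d * lam / (4 * η ^ 3)) / 2 := h3
    _ ≤ c * N / 2 := by gcongr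

/-- **The parameters of the proof of Lemma 2.3 in the main range** (Kozma–Nachmias 2011,
pp. 382–384, with `ε = η^{10}`): given `d ≥ 7`, `0 < c ≤ 1/2`, `0 < λ ≤ 1`,
`0 < η ≤ c²λ/(4096d³)`, `r ≥ max(1, j₀)` and the main-range condition `η^{10} r³ > (4d)^{10}`, the
radii `j₁ = ⌈r(1+λ/4)⌉`, `j₂ = ⌊r(1+λ/2)⌋ - 1`, the width `L = ⌊η³r/(2d)⌋`, the number of radii
`N = ⌊(j₂-j₁)/L⌋ + 1` and the volume cut-off `V = ⌈η^{10}r⁴⌉` satisfy: `j₂ + 1 + ⌊λr/2⌋ ≤ ⌊r(1+λ)⌋`;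
`L, N, V ≥ 1`; `j₁ + iL ≤ j₂` for `i < N`; `L² ≤ η⁶r²/(2d)`; `V/(cL⁴) ≤ cN/2` (the Markov step);
the hypotheses of Theorem 2 at each `j = j₁ + iL` (`j ≥ j₀`, `j^{1/10} ≤ L ≤ j`);
`⌊r⌋ ≤ j₁`, `1 ≤ ⌊r⌋`; and `η^{10}r⁴ ≤ V`.
[cite: KozmaNachmias2011, proof of Lemma 2.3 (pp. 382–384, choice of L, j_i and ε₀(λ))] -/
theorem lemma23_parameters (hd : 7 ≤ d) (hc0 : 0 < c) (hc2 : c ≤ 1 / 2)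
    (hlam0 : 0 < lam) (hlam1 : lam ≤ 1) (hη0 : 0 < η) (hη : η ≤ c ^ 2 * lam / (4096 * d ^ 3))
    (hr : 1 ≤ r) (hrange : (4 * d : ℝ) ^ 10 < η ^ 10 * r ^ 3) {j₀ : ℕ} (hj₀ : (j₀ : ℝ) ≤ r) :
    ∃ j₁ j₂ L N V : ℕ,
      j₂ + 1 + ⌊lam * r / 2⌋₊ ≤ ⌊r * (1 + lam)⌋₊ ∧ 1 ≤ L ∧ 1 ≤ N ∧ (∀ i < N, j₁ + i * L ≤ j₂) ∧
      ((L : ℝ)) ^ 2 ≤ η ^ 6 * r ^ 2 / (2 * d) ∧ (V : ℝ) / (c * (L : ℝ) ^ 4) ≤ c * N / 2 ∧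
      (∀ i < N, j₀ ≤ j₁ + i * L ∧ ((j₁ + i * L : ℕ) : ℝ) ^ ((1 : ℝ) / 10) ≤ L ∧ L ≤ j₁ + i * L) ∧
      ⌊r⌋₊ ≤ j₁ ∧ 1 ≤ ⌊r⌋₊ ∧ η ^ 10 * r ^ 4 ≤ V ∧ 1 ≤ V := by
  have hd0 : (0 : ℝ) < d := by exact_mod_cast (show 0 < d by omega)
  have hd1 : (1 : ℝ) ≤ d := by exact_mod_cast (show 1 ≤ d by omega)
  have hr0 : 0 < r := by linarith
  obtain ⟨h64, hL10⟩ := range_consequences hd hη0 hr hrange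
  obtain ⟨-, hη1, -, hlamr⟩ := lemma23_smallness hd hc0 hc2 hlam0 hlam1 hη0 hη hr h64
  obtain ⟨hP1, hj₁ge, hj₂le, hdiff, hj₁j₂, hP10, hfl1⟩ := lemma23_radii hlam0 hr hlamr
  obtain ⟨hL1, hLlow, hLr, hP5, hL10'⟩ := lemma23_width hd hη0 hη1 hr h64 hL10
  set j₁ : ℕ := ⌈r * (1 + lam / 4)⌉₊ with hj₁
  set j₂ : ℕ := ⌊r * (1 + lam / 2)⌋₊ - 1 with hj₂
  set L : ℕ := ⌊η ^ 3 * r / (2 * d)⌋₊ with hL_def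
  have hL0 : (0 : ℝ) < L := by exact_mod_cast hL1
  have hLx : (L : ℝ) ≤ η ^ 3 * r / (2 * d) := Nat.floor_le (by positivity)
  obtain ⟨hN1, hP4, hNlow⟩ := lemma23_count (r := r) hL1 hj₁j₂ hlam0 hη0 hd0 hdiff hLx
  set N : ℕ := (j₂ - j₁) / L + 1 with hN_def
  -- the volume cut-off `V`
  set V : ℕ := ⌈η ^ 10 * r ^ 4⌉₊ with hV_def
  have hVge : η ^ 10 * r ^ 4 ≤ V := Nat.le_ceil _
  have hbig : 1 ≤ η ^ 10 * r ^ 4 := by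
    have h1 : (1 : ℝ) ≤ (4 * d : ℝ) ^ 10 := one_le_pow₀ (by linarith)
    have h2 : η ^ 10 * r ^ 3 ≤ η ^ 10 * r ^ 4 := by
      rw [show r ^ 4 = r ^ 3 * r by ring]
      exact mul_le_mul_of_nonneg_left (le_mul_of_one_le_right (by positivity) hr) (by positivity)
    linarith
  have hV1 : 1 ≤ V := by
    have : (1 : ℝ) ≤ V := hbig.trans hVge
    exact_mod_cast this
  have hVle : (V : ℝ) ≤ 2 * (η ^ 10 * r ^ 4) := by
    have h1 : (V : ℝ) < η ^ 10 * r ^ 4 + 1 := Nat.ceil_lt_add_one (by positivity)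
    linarith
  have hP8 := lemma23_markov_step (L := L) (N := N) hc0 hlam0 hη0 hr0 hd0 hη hVle hLlow hNlow
  -- Theorem 2's hypotheses at the radii `j = j₁ + iL`
  have hP9 : ∀ i < N, j₀ ≤ j₁ + i * L ∧ ((j₁ + i * L : ℕ) : ℝ) ^ ((1 : ℝ) / 10) ≤ L ∧
      L ≤ j₁ + i * L := by
    intro i hi
    have hrj₁ : r ≤ j₁ := (le_mul_of_one_le_right hr0.le (by linarith)).trans hj₁ge
    have hj₀j₁ : j₀ ≤ j₁ := by exact_mod_cast hj₀.trans hrj₁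
    have hLj₁ : L ≤ j₁ := by exact_mod_cast hLr.trans hrj₁
    refine ⟨hj₀j₁.trans (Nat.le_add_right _ _), ?_, hLj₁.trans (Nat.le_add_right _ _)⟩
    refine rpow_one_div_le_of_le_pow (by positivity) hL0.le (by norm_num) ?_
    have h1 : ((j₁ + i * L : ℕ) : ℝ) ≤ j₂ := by exact_mod_cast hP4 i hi
    calc ((j₁ + i * L : ℕ) : ℝ) ≤ j₂ := h1
      _ ≤ r * (1 + lam / 2) := hj₂le
      _ ≤ 2 * r := by nlinarith
      _ ≤ (L : ℝ) ^ 10 := hL10'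
  exact ⟨j₁, j₂, L, N, V, hP1, hL1, hN1, hP4, hP5, hP8, hP9, hP10, hfl1, hVge, hV1⟩

end Parameters

end Literature.Barriers.CriticalPhenomena

end
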